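import Summits.ResolutionOfSingularities.ResolutionOfSingularities.Theorems.UniversalCellsLocalToGlobalHSTowerDefs
import HarnessLib

/-!
# `LocalToGlobal` (crux stmt-ResolutionOfSingularities-15232, route UniversalCells), line `Sketch`
# (idea `existence-certified-termination`) — stub `stub_exists_stage_of_pointwise`

Helper file (`--supports stmt-ResolutionOfSingularities-15232`; does not close the item).
Objects: `Theorems/UniversalCellsLocalToGlobalHSTowerDefs.lean` (the blind lex-maximal
Hilbert–Samuel tower: `hsCentre`, `hsStep`, `NormalVariety.step`, `stepπ`, `iterπ`, `IsResolvedOver`).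

**Statement.** For a normal variety `V` over a field `k` and a level `N`: if the loci
`{x | V.IsResolvedOver N n x}` ("stage `n` of the blind tower is regular over `x`") increase with
`n`, are open, and cover `V.X` (pointwise termination), then a single stage `n` is regular over
every point of `V`.

**Proof (pure topology).** `V.X` is quasi-compact: the structure map `V.hom : V.X ⟶ Spec k` is
`QuasiCompact` (`NormalVariety.instQuasiCompactHom`) and over the affine base this is
`CompactSpace V.X` (`HasAffineProperty.iff_of_isAffine` for `@QuasiCompact`). Iterating the
one-step monotonicity gives `m ≤ n → U m ⊆ U n`, so the family of loci is directed
(`Monotone.directed_le`); it is an open cover of the compact `Set.univ`, hence one member already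
contains `Set.univ` (`IsCompact.elim_directed_cover`). No unfolding of `IsResolvedOver`.
-/

set_option linter.dupNamespace false -- mandated namespace of this single-conjunct summit

noncomputable section

open CategoryTheory AlgebraicGeometry TopologicalSpace Topology
open AlgebraicGeometry.Scheme.IdealSheafData
open Literature.AlgebraicGeometry.Resolution

namespace Summit.ResolutionOfSingularities.ResolutionOfSingularities.Theorems.LocalToGlobal.HSTower

/-! ## The stub -/

/-- **Stub `stub_exists_stage_of_pointwise` of line `Sketch` — (globalization: pointwise termination ⇒ a regular stage).** If the resolved-over loci
increase with the stage, are open, and cover `V` (pointwise termination), then by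
quasi-compactness of `V` a single stage is regular over every point. [folklore] -/
theorem stub_exists_stage_of_pointwise (k : Type) [Field k] (V : NormalVariety k) (N : ℕ)
    (hmono : ∀ (n : ℕ) (x : V.X), V.IsResolvedOver N n x → V.IsResolvedOver N (n + 1) x)
    (hopen : ∀ n : ℕ, IsOpen {x : V.X | V.IsResolvedOver N n x})
    (hpt : ∀ x : V.X, ∃ n : ℕ, V.IsResolvedOver N n x) :
    ∃ n : ℕ, ∀ x : V.X, V.IsResolvedOver N n x := by
  -- `V.X` is quasi-compact: `QuasiCompact V.hom` over the affine base `Spec k`.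
  haveI : CompactSpace V.X :=
    (HasAffineProperty.iff_of_isAffine (P := @QuasiCompact)).mp V.instQuasiCompactHom
  -- Monotonicity of the resolved-over loci along `m ≤ n` (iterate `hmono`).
  have hmono' : ∀ {m n : ℕ}, m ≤ n → ∀ x : V.X, V.IsResolvedOver N m x →
      V.IsResolvedOver N n x := by
    intro m n hmn
    induction hmn with
    | refl => exact fun x hx => hx
    | step _ ih => exact fun x hx => hmono _ x (ih x hx)
  -- The loci form a directed open cover of the compact space `V.X`: one member suffices.
  obtain ⟨n, hn⟩ := isCompact_univ.elim_directed_cover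
    (fun n => {x : V.X | V.IsResolvedOver N n x}) hopen (fun x _ => Set.mem_iUnion.mpr (hpt x))
    (Monotone.directed_le fun m n hmn x hx => hmono' hmn x hx)
  exact ⟨n, fun x => hn (Set.mem_univ x)⟩

end Summit.ResolutionOfSingularities.ResolutionOfSingularities.Theorems.LocalToGlobal.HSTower

end
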